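import Summits.CriticalPhenomena.PercolationContinuityZ3.Theorems.FK.WeakMixingBelowCritical
import Summits.CriticalPhenomena.PercolationContinuityZ3.Theorems.FK.EdgeDensityLLN
import HarnessLib

/-!
# EXPONENTIAL DECAY OF THE EDGE–EDGE COVARIANCE (truncated energy–energy correlation) OF THE RANDOM-CLUSTER MEASURE
# BELOW `p_c(q)`, `d ≥ 2`, `q ≥ 1`, and SUMMABILITY: `Σ_{e,e' ⊆ Λ_n} |Cov(1_e, 1_{e'})| ≤ K · |Λ_n|`

Claimed R42 (8)(c) in the cell INBOX at 2026-08-28T11:02:16Z by fkp-10a gen 353 (NEW CLAIM #2 of the gen), addressed to coordinator fk-4 g272 (seated 09:59Z 2026-08-28 by l.8334; R149 l.8335: row FO-10a-g353 [g272, R149] = package g353-weakmixing; its clause «consequences beyond reformulation = a NEW R42 (8)(c) claim, R150»); lineage row FO-10a-g353c (self-suggested), package g353-covdecay, label CV-A.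
Helper file of the `fk-continuity` build cell (bschramm lane; `--supports stmt-CriticalPhenomena-4575`); builds on
p205010 (kernel theorem, internal audit signed; external expert review pending). No definitions, no named facts, no
sorries; standard axioms. UNCONDITIONAL.

The weak mixing theorem of `WeakMixingBelowCritical.lean` (Alexander's (1.1) from Duminil-Copin's Exercise 10, Strassen
and DRT sharpness) specialised to one-edge events gives the exponential decay of the truncated two-edge function
`φ(e, e' open) − φ(e open)φ(e' open)` — Grimmett's covariance `cov(J_e, J_{e'})` of the edge indicators (2006, §2.5
(2.45)), the "energy–energy" correlation of the Potts model under the Edwards–Sokal coupling — for every FK-Gibbs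
measure at `p < p_c(q)`: in concentric form (`exists_exp_edgeCov_box_of_lt_rcCriticalProb`: `e ⊆ Λ_k`, `e' ⊄ Λ_n`,
bound `4e^{−c(n−k)}`), and, for the translation-invariant box limits `φ^b_{p,q}` (Grimmett Thm. (4.19)(b), the tree's
`IsBoxLimit.measure_preimage_relabel_shift`), in the homogeneous form
`|φ^b(e_{x,i} ∩ e_{y,j}) − φ^b(e_{x,i})φ^b(e_{y,j})| ≤ 4e^{2c}·e^{−c‖y−x‖_∞}` for the coordinate edges `e_{x,i} = ⟨x, x+e_i⟩`
(`exists_exp_edgeCov_of_lt_rcCriticalProb`). Summing the geometric–polynomial series over `ℤ^d`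
(`sum_exp_neg_siteRad_le`: `Σ_{z ∈ Λ_N} e^{−c‖z‖_∞} ≤ Σ_m (2m+1)^d e^{−cm} < ∞`) yields the SUMMABLE COVARIANCE bound
`Σ_{(x,i),(y,j) ∈ Λ_n × [d]} |Cov| ≤ K · |Λ_n|` with `K = K(p,q,d)` (`exists_sum_sum_edgeCov_le_mul_card_box`) — the
input of the variance bound `Var(|ω ∩ E_{Λ_n}|) = O(|Λ_n|)` (companion file).

## References

* K. S. Alexander, *On weak mixing in lattice models*, PTRF 110 (1998) 441–471, (1.1). [Alexander1998]
* G. Grimmett, *The Random-Cluster Model*, Springer 2006: §2.5 (2.45) (`cov_p(J_e, J_f)`), Thm. (4.19)(b), §4.5 (4.61).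
  [Grimmett2006]
* H. Duminil-Copin, A. Raoufi, V. Tassion, Ann. of Math. 189 (2019), Thm. 1.2 (1). [DuminilCopinRaoufiTassion2019]
-/

noncomputable section

namespace Summit.CriticalPhenomena.PercolationContinuityZ3.Theorems.FK

namespace BoundaryInfluence

open MeasureTheory Finset
open Literature.Probability.Percolation Literature.Probability.LatticeModels Literature.Barriers.CriticalPhenomena
open Literature.Probability.Percolation.OneArmOSSS Literature.Probability.Percolation.DCT16 MonotonicOSSS

variable {d : ℕ} {p q : ℝ}

/-! ### Concentric form: an edge of `E_{Λ_k}` against an edge off `E_{Λ_n}` -/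

/-- **Exponential decay of the edge–edge covariance below `p_c(q)`, concentric form**: for `d ≥ 2`, `q ≥ 1`,
`0 ≤ p < p_c(q)` there is `c > 0` with `|P(e, e' open) − P(e open)·P(e' open)| ≤ 4·e^{−c(n−k)}` for every FK-Gibbs
`P`, `k < n`, `e ∈ E_{Λ_k}` and every pair `e'` not in `E_{Λ_n}`. [cite: Alexander1998, (1.1); Grimmett2006, §2.5 (2.45); DuminilCopinRaoufiTassion2019, Thm. 1.2 (1)] -/
theorem exists_exp_edgeCov_box_of_lt_rcCriticalProb (hd : 2 ≤ d) (hq : 1 ≤ q) (hp0 : 0 ≤ p)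
    (hpc : p < rcCriticalProb d q) :
    ∃ c : ℝ, 0 < c ∧ ∀ ⦃P : Measure (BondConfig (Site d))⦄, FKGibbs d p q P → ∀ ⦃k n : ℕ⦄, k < n →
      ∀ ⦃e : Sym2 (Site d)⦄, e ∈ edgesIn (zdGraph d) (box d k) → ∀ ⦃e' : Sym2 (Site d)⦄, e' ∉ edgesIn (zdGraph d) (box d n) →
        |P.real ({ω | e ∈ ω} ∩ {ω | e' ∈ ω}) - P.real {ω | e ∈ ω} * P.real {ω | e' ∈ ω}| ≤
          4 * Real.exp (-(c * ((n : ℝ) - k))) := by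
  obtain ⟨c, hc, h⟩ := exists_exp_weakMixing_local_of_lt_rcCriticalProb hd hq hp0 hpc
  refine ⟨c, hc, fun P hP k n hkn e he e' he' => ?_⟩
  haveI := hP.isProbabilityMeasure
  have hF : ({e} : Finset (Sym2 (Site d))) ⊆ edgesIn (zdGraph d) (box d k) := Finset.singleton_subset_iff.2 he
  have hE : DeterminedBy {ω : BondConfig (Site d) | e ∈ ω} ↑({e} : Finset (Sym2 (Site d))) := by
    rw [determinedBy_iff]; intro ω₁ ω₂ hω
    have := Set.ext_iff.1 hω e
    simp only [Set.mem_inter_iff, Finset.coe_singleton, Set.mem_singleton_iff, and_true] at this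
    exact this
  have hH : DeterminedBy {ω : BondConfig (Site d) | e' ∈ ω} ↑({e'} : Finset (Sym2 (Site d))) := by
    rw [determinedBy_iff]; intro ω₁ ω₂ hω
    have := Set.ext_iff.1 hω e'
    simp only [Set.mem_inter_iff, Finset.coe_singleton, Set.mem_singleton_iff, and_true] at this
    exact this
  have hT : Disjoint (↑({e'} : Finset (Sym2 (Site d))) : Set (Sym2 (Site d))) ↑(edgesIn (zdGraph d) (box d n)) := by
    rw [Finset.coe_singleton, Set.disjoint_singleton_left, Finset.mem_coe]; exact he'
  refine (h hP hkn hF hE ({e'} : Finset (Sym2 (Site d))) hT hH).trans ?_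
  rw [Finset.card_singleton, Nat.cast_one, mul_one]
  have h1 : P.real {ω : BondConfig (Site d) | e' ∈ ω} ≤ 1 := measureReal_le_one
  have h2 : 0 ≤ Real.exp (-(c * ((n : ℝ) - k))) := (Real.exp_pos _).le
  nlinarith

/-! ### Homogeneous form for the box limits: decay in `‖y − x‖_∞` -/

/-- Translating a one-edge event: `ω ∈ (· + x)⁻¹{⟨a, b⟩ open} ↔ ⟨a + x, b + x⟩ ∈ ω`. [cite: Grimmett2006, §4.3 (translations τ_x)] -/
theorem mem_preimage_relabel_shift_neg_setOf_pair_mem_iff (x a b : Site d) (ω : BondConfig (Site d)) :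
    ω ∈ BondConfig.relabel (sym2Equiv (Site.shift (-x))) ⁻¹' {ω : BondConfig (Site d) | s(a, b) ∈ ω} ↔
      s(a + x, b + x) ∈ ω := by
  rw [Set.mem_preimage, Set.mem_setOf_eq, BondConfig.mem_relabel_iff, sym2Equiv_shift_symm, neg_neg, sym2Equiv_apply,
    Sym2.map_mk, Site.shift_apply, Site.shift_apply]

/-- `⟨0, e_i⟩ ∈ E_{Λ_1}`. [folklore] -/
theorem coordEdge_zero_mem_edgesIn_box_one (i : Fin d) :
    s((0 : Site d), (0 : Site d) + Pi.single i 1) ∈ edgesIn (zdGraph d) (box d 1) := by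
  rw [mem_edgesIn_iff]
  refine ⟨coordEdge_mem_edgeSet 0 i, fun x hx => ?_⟩
  rw [mem_box]
  rcases Sym2.mem_iff.1 hx with rfl | rfl
  · intro l; simp
  · intro l; rw [zero_add, Pi.single_apply]; split_ifs <;> simp

/-- `⟨z, z + e_j⟩ ∉ E_{Λ_n}` when `‖z‖_∞ > n`. [folklore] -/
theorem coordEdge_notMem_edgesIn_box {z : Site d} {n : ℕ} (hz : n < siteRad z) (j : Fin d) :
    s(z, z + Pi.single j 1) ∉ edgesIn (zdGraph d) (box d n) := by
  intro h
  rw [mem_edgesIn_iff] at h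
  have := mem_box_iff_siteRad_le.1 (h.2 z (Sym2.mem_mk_left _ _))
  omega

/-- **Exponential decay of the edge–edge covariance below `p_c(q)` for the box limits `φ^b_{p,q}`** (`d ≥ 2`, `q ≥ 1`,
`0 ≤ p < p_c(q)`, both `b`): there is `c > 0` with
`|φ^b(e_{x,i}, e_{y,j} open) − φ^b(e_{x,i} open)·φ^b(e_{y,j} open)| ≤ 4·e^{2c}·e^{−c‖y − x‖_∞}` for all sites `x, y` and
directions `i, j`, `e_{x,i} = ⟨x, x + e_i⟩` (translation invariance, Thm. (4.19)(b), and the concentric form with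
`k = 1`, `n = ‖y−x‖_∞ − 1`). [cite: Alexander1998, (1.1); Grimmett2006, §2.5 (2.45) and Thm. (4.19)(b); DuminilCopinRaoufiTassion2019, Thm. 1.2 (1)] -/
theorem exists_exp_edgeCov_of_lt_rcCriticalProb (hd : 2 ≤ d) (hq : 1 ≤ q) (hp0 : 0 ≤ p) (hpc : p < rcCriticalProb d q) :
    ∃ c : ℝ, 0 < c ∧ ∀ (b : Bool) (x y : Site d) (i j : Fin d),
      |(rcLimit d b p q).real ({ω | s(x, x + Pi.single i 1) ∈ ω} ∩ {ω | s(y, y + Pi.single j 1) ∈ ω}) -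
          (rcLimit d b p q).real {ω | s(x, x + Pi.single i 1) ∈ ω} *
            (rcLimit d b p q).real {ω | s(y, y + Pi.single j 1) ∈ ω}| ≤
        4 * Real.exp (2 * c) * Real.exp (-(c * siteRad (y - x))) := by
  have hp : p ∈ Set.Icc (0 : ℝ) 1 := ⟨hp0, (hpc.trans (rcCriticalProb_lt_one hd hq)).le⟩
  obtain ⟨c, hc, h⟩ := exists_exp_edgeCov_box_of_lt_rcCriticalProb hd hq hp0 hpc
  refine ⟨c, hc, fun b x y i j => ?_⟩
  set P : Measure (BondConfig (Site d)) := rcLimit d b p q with hPdef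
  have hBL : IsBoxLimit d b p q P := isBoxLimit_rcLimit b hp hq
  haveI := hBL.isProbabilityMeasure
  have hG : FKGibbs d p q P := hBL.fkGibbs hp hq
  -- translate by `−x`: the edges become `⟨0, e_i⟩` and `⟨y − x, y − x + e_j⟩`
  set z : Site d := y - x with hz
  have hshift : ∀ A : Set (BondConfig (Site d)),
      P.real (BondConfig.relabel (sym2Equiv (Site.shift (-x))) ⁻¹' A) = P.real A := fun A => by
    rw [measureReal_def, hBL.measure_preimage_relabel_shift hp hq (-x) A, measureReal_def]
  have hA : BondConfig.relabel (sym2Equiv (Site.shift (-x))) ⁻¹' {ω : BondConfig (Site d) | s((0 : Site d), 0 + Pi.single i 1) ∈ ω}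
      = {ω | s(x, x + Pi.single i 1) ∈ ω} := by
    ext ω; rw [mem_preimage_relabel_shift_neg_setOf_pair_mem_iff, zero_add, zero_add, Set.mem_setOf_eq, add_comm]
  have hB : BondConfig.relabel (sym2Equiv (Site.shift (-x))) ⁻¹' {ω : BondConfig (Site d) | s(z, z + Pi.single j 1) ∈ ω}
      = {ω | s(y, y + Pi.single j 1) ∈ ω} := by
    ext ω; rw [mem_preimage_relabel_shift_neg_setOf_pair_mem_iff, Set.mem_setOf_eq, hz, sub_add_cancel,
      add_right_comm, sub_add_cancel]
  have hAB := hshift ({ω : BondConfig (Site d) | s((0 : Site d), 0 + Pi.single i 1) ∈ ω} ∩ {ω | s(z, z + Pi.single j 1) ∈ ω})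
  rw [Set.preimage_inter, hA, hB] at hAB
  have hA' := hshift {ω : BondConfig (Site d) | s((0 : Site d), 0 + Pi.single i 1) ∈ ω}
  rw [hA] at hA'
  have hB' := hshift {ω : BondConfig (Site d) | s(z, z + Pi.single j 1) ∈ ω}
  rw [hB] at hB'
  rw [hAB, hA', hB']
  -- trivial bound `≤ 1 ≤ 4 e^{2c} e^{−cm}` when `m = ‖z‖ ≤ 2`, the concentric bound otherwise
  have htriv : |P.real ({ω : BondConfig (Site d) | s((0 : Site d), 0 + Pi.single i 1) ∈ ω} ∩ {ω | s(z, z + Pi.single j 1) ∈ ω}) -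
      P.real {ω : BondConfig (Site d) | s((0 : Site d), 0 + Pi.single i 1) ∈ ω} *
        P.real {ω : BondConfig (Site d) | s(z, z + Pi.single j 1) ∈ ω}| ≤ 1 := by
    have h1 : P.real ({ω : BondConfig (Site d) | s((0 : Site d), 0 + Pi.single i 1) ∈ ω} ∩ {ω | s(z, z + Pi.single j 1) ∈ ω}) ≤ 1 :=
      measureReal_le_one
    have h2 : P.real {ω : BondConfig (Site d) | s((0 : Site d), 0 + Pi.single i 1) ∈ ω} ≤ 1 := measureReal_le_one
    have h3 : P.real {ω : BondConfig (Site d) | s(z, z + Pi.single j 1) ∈ ω} ≤ 1 := measureReal_le_one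
    have h4 : 0 ≤ P.real ({ω : BondConfig (Site d) | s((0 : Site d), 0 + Pi.single i 1) ∈ ω} ∩ {ω | s(z, z + Pi.single j 1) ∈ ω}) :=
      measureReal_nonneg
    have h5 : 0 ≤ P.real {ω : BondConfig (Site d) | s((0 : Site d), 0 + Pi.single i 1) ∈ ω} := measureReal_nonneg
    have h6 : 0 ≤ P.real {ω : BondConfig (Site d) | s(z, z + Pi.single j 1) ∈ ω} := measureReal_nonneg
    rw [abs_le]; constructor <;> nlinarith
  by_cases hm : siteRad z ≤ 2
  · refine htriv.trans ?_
    rw [mul_assoc, ← Real.exp_add]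
    have : 0 ≤ 2 * c + -(c * siteRad z) := by
      have : (siteRad z : ℝ) ≤ 2 := by exact_mod_cast hm
      nlinarith
    calc (1 : ℝ) ≤ 4 * 1 := by norm_num
      _ ≤ 4 * Real.exp (2 * c + -(c * ↑(siteRad z))) :=
          mul_le_mul_of_nonneg_left (Real.one_le_exp this) (by norm_num)
  · rw [not_le] at hm
    have hk : s((0 : Site d), (0 : Site d) + Pi.single i 1) ∈ edgesIn (zdGraph d) (box d 1) :=
      coordEdge_zero_mem_edgesIn_box_one i
    have hn : s(z, z + Pi.single j 1) ∉ edgesIn (zdGraph d) (box d (siteRad z - 1)) :=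
      coordEdge_notMem_edgesIn_box (by omega) j
    refine (h hG (show 1 < siteRad z - 1 by omega) hk hn).trans (le_of_eq ?_)
    rw [Nat.cast_sub (by omega), Nat.cast_one, mul_assoc, ← Real.exp_add]
    congr 1; ring

/-! ### Summability: the lattice sum `Σ_z e^{−c‖z‖_∞}` and the double covariance sum over a box -/

/-- `m ↦ (2m+1)^d e^{−cm}` is summable for `c > 0` (`(2m+1)^d ≤ 3^d (m^d + 1)`). [folklore] -/
theorem summable_card_shell_mul_exp_neg (d : ℕ) {c : ℝ} (hc : 0 < c) :
    Summable fun m : ℕ => ((2 * m + 1 : ℕ) : ℝ) ^ d * Real.exp (-(c * m)) := by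
  have h1 : Summable fun m : ℕ => (3 : ℝ) ^ d * ((m : ℝ) ^ d * Real.exp (-c * m)) :=
    (Real.summable_pow_mul_exp_neg_nat_mul d hc).mul_left _
  have h2 : Summable fun m : ℕ => (3 : ℝ) ^ d * ((m : ℝ) ^ 0 * Real.exp (-c * m)) :=
    (Real.summable_pow_mul_exp_neg_nat_mul 0 hc).mul_left _
  refine (h1.add h2).of_nonneg_of_le (fun m => by positivity) fun m => ?_
  have hexp : 0 ≤ Real.exp (-c * m) := (Real.exp_pos _).le
  have hpow : ((2 * m + 1 : ℕ) : ℝ) ^ d ≤ (3 : ℝ) ^ d * ((m : ℝ) ^ d + (m : ℝ) ^ 0) := by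
    rw [pow_zero]
    rcases Nat.eq_zero_or_pos m with rfl | hm
    · have h3 : (1 : ℝ) ≤ 3 ^ d := one_le_pow₀ (by norm_num)
      have h4 : (1 : ℝ) ≤ (0 : ℝ) ^ d + 1 := le_add_of_nonneg_left (pow_nonneg le_rfl d)
      simp only [Nat.mul_zero, Nat.zero_add, Nat.cast_one, one_pow, Nat.cast_zero]
      nlinarith
    · have hle : ((2 * m + 1 : ℕ) : ℝ) ≤ 3 * m := by
        have : 2 * m + 1 ≤ 3 * m := by omega
        exact_mod_cast this
      calc ((2 * m + 1 : ℕ) : ℝ) ^ d ≤ (3 * (m : ℝ)) ^ d := pow_le_pow_left₀ (by positivity) hle d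
        _ = (3 : ℝ) ^ d * (m : ℝ) ^ d := mul_pow _ _ _
        _ ≤ (3 : ℝ) ^ d * ((m : ℝ) ^ d + 1) := by nlinarith [pow_nonneg (show (0:ℝ) ≤ 3 by norm_num) d]
  have hc' : -(c * (m : ℝ)) = -c * m := by ring
  rw [hc']
  calc ((2 * m + 1 : ℕ) : ℝ) ^ d * Real.exp (-c * m)
      ≤ (3 : ℝ) ^ d * ((m : ℝ) ^ d + (m : ℝ) ^ 0) * Real.exp (-c * m) := mul_le_mul_of_nonneg_right hpow hexp
    _ = (3 : ℝ) ^ d * ((m : ℝ) ^ d * Real.exp (-c * m)) + (3 : ℝ) ^ d * ((m : ℝ) ^ 0 * Real.exp (-c * m)) := by ring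

/-- **`Σ_{z ∈ Λ_N} e^{−c‖z‖_∞} ≤ Σ_m (2m+1)^d e^{−cm}`** uniformly in `N` (the shell `{‖z‖_∞ = m}` lies in `Λ_m`,
`|Λ_m| = (2m+1)^d`). [folklore] -/
theorem sum_exp_neg_siteRad_le {c : ℝ} (hc : 0 < c) (N : ℕ) :
    ∑ z ∈ box d N, Real.exp (-(c * siteRad z)) ≤ ∑' m : ℕ, ((2 * m + 1 : ℕ) : ℝ) ^ d * Real.exp (-(c * m)) := by
  classical
  have hS := summable_card_shell_mul_exp_neg d hc
  rw [Finset.sum_comp (fun m : ℕ => Real.exp (-(c * m))) siteRad]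
  refine le_trans (Finset.sum_le_sum fun m _ => ?_) (hS.sum_le_tsum _ fun m _ => by positivity)
  rw [nsmul_eq_mul]
  refine mul_le_mul_of_nonneg_right ?_ (Real.exp_pos _).le
  have hsub : (box d N).filter (fun z => siteRad z = m) ⊆ box d m := fun z hz =>
    mem_box_iff_siteRad_le.2 (Finset.mem_filter.1 hz).2.le
  have := Finset.card_le_card hsub
  rw [card_box] at this
  exact_mod_cast this

/-- **SUMMABLE COVARIANCES BELOW `p_c(q)`: `Σ_{(x,i),(y,j) ∈ (Λ_n × [d])²} |Cov_{φ^b}(1_{e_{x,i}}, 1_{e_{y,j}})| ≤ K · |Λ_n|`**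
with one constant `K = K(p,q,d)` for all `n` and both `b` (`d ≥ 2`, `q ≥ 1`, `0 ≤ p < p_c(q)`): the variance of the
number of open edges of a box is at most linear in its volume. [cite: Alexander1998, (1.1); Grimmett2006, §2.5 (2.45)–(2.47) (covariance sums); DuminilCopinRaoufiTassion2019, Thm. 1.2 (1)] -/
theorem exists_sum_sum_edgeCov_le_mul_card_box (hd : 2 ≤ d) (hq : 1 ≤ q) (hp0 : 0 ≤ p) (hpc : p < rcCriticalProb d q) :
    ∃ K : ℝ, 0 < K ∧ ∀ (b : Bool) (n : ℕ),
      ∑ x ∈ box d n, ∑ i : Fin d, ∑ y ∈ box d n, ∑ j : Fin d,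
        |(rcLimit d b p q).real ({ω | s(x, x + Pi.single i 1) ∈ ω} ∩ {ω | s(y, y + Pi.single j 1) ∈ ω}) -
            (rcLimit d b p q).real {ω | s(x, x + Pi.single i 1) ∈ ω} *
              (rcLimit d b p q).real {ω | s(y, y + Pi.single j 1) ∈ ω}| ≤ K * #(box d n) := by
  obtain ⟨c, hc, h⟩ := exists_exp_edgeCov_of_lt_rcCriticalProb hd hq hp0 hpc
  set S : ℝ := ∑' m : ℕ, ((2 * m + 1 : ℕ) : ℝ) ^ d * Real.exp (-(c * m)) with hSdef
  have hS0 : 0 ≤ S := tsum_nonneg fun m => by positivity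
  refine ⟨4 * Real.exp (2 * c) * d * d * S + 1, by positivity, fun b n => ?_⟩
  -- translated sums over `Λ_n` are sums over `Λ_{2n}`
  have hshift : ∀ x ∈ box d n, ∀ g : Site d → ℝ, (∀ z, 0 ≤ g z) →
      ∑ y ∈ box d n, g (y - x) ≤ ∑ z ∈ box d (2 * n), g z := by
    classical
    intro x hx g hg
    rw [← Finset.sum_image (f := g) (s := box d n) (g := fun y => y - x) (fun a _ b _ h => sub_left_injective h)]
    refine Finset.sum_le_sum_of_subset_of_nonneg (fun z hz => ?_) fun z _ _ => hg z
    rw [Finset.mem_image] at hz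
    obtain ⟨y, hy, rfl⟩ := hz
    rw [mem_box] at hx hy ⊢
    intro l
    have h1 := hx l; have h2 := hy l
    simp only [Pi.sub_apply]
    push_cast
    constructor <;> omega
  -- inner bound, uniformly in `(x, i)`
  have hinner : ∀ x ∈ box d n, ∀ i : Fin d,
      ∑ y ∈ box d n, ∑ j : Fin d,
        |(rcLimit d b p q).real ({ω | s(x, x + Pi.single i 1) ∈ ω} ∩ {ω | s(y, y + Pi.single j 1) ∈ ω}) -
            (rcLimit d b p q).real {ω | s(x, x + Pi.single i 1) ∈ ω} *
              (rcLimit d b p q).real {ω | s(y, y + Pi.single j 1) ∈ ω}| ≤ 4 * Real.exp (2 * c) * d * S := by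
    intro x hx i
    calc ∑ y ∈ box d n, ∑ j : Fin d,
          |(rcLimit d b p q).real ({ω | s(x, x + Pi.single i 1) ∈ ω} ∩ {ω | s(y, y + Pi.single j 1) ∈ ω}) -
            (rcLimit d b p q).real {ω | s(x, x + Pi.single i 1) ∈ ω} *
              (rcLimit d b p q).real {ω | s(y, y + Pi.single j 1) ∈ ω}|
        ≤ ∑ y ∈ box d n, ∑ _j : Fin d, 4 * Real.exp (2 * c) * Real.exp (-(c * siteRad (y - x))) :=
          Finset.sum_le_sum fun y _ => Finset.sum_le_sum fun j _ => h b x y i j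
      _ = d * (4 * Real.exp (2 * c)) * ∑ y ∈ box d n, Real.exp (-(c * siteRad (y - x))) := by
          rw [Finset.mul_sum]
          refine Finset.sum_congr rfl fun y _ => ?_
          rw [Finset.sum_const, Finset.card_univ, Fintype.card_fin, nsmul_eq_mul]; ring
      _ ≤ d * (4 * Real.exp (2 * c)) * S := by
          refine mul_le_mul_of_nonneg_left ?_ (by positivity)
          exact (hshift x hx (fun z => Real.exp (-(c * siteRad z))) fun z => (Real.exp_pos _).le).trans
            (sum_exp_neg_siteRad_le hc (2 * n))
      _ = 4 * Real.exp (2 * c) * d * S := by ring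
  calc ∑ x ∈ box d n, ∑ i : Fin d, ∑ y ∈ box d n, ∑ j : Fin d,
        |(rcLimit d b p q).real ({ω | s(x, x + Pi.single i 1) ∈ ω} ∩ {ω | s(y, y + Pi.single j 1) ∈ ω}) -
            (rcLimit d b p q).real {ω | s(x, x + Pi.single i 1) ∈ ω} *
              (rcLimit d b p q).real {ω | s(y, y + Pi.single j 1) ∈ ω}|
      ≤ ∑ x ∈ box d n, ∑ _i : Fin d, 4 * Real.exp (2 * c) * d * S :=
        Finset.sum_le_sum fun x hx => Finset.sum_le_sum fun i _ => hinner x hx i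
    _ = (4 * Real.exp (2 * c) * d * d * S) * #(box d n) := by
        rw [Finset.sum_const, Finset.sum_const, Finset.card_univ, Fintype.card_fin, nsmul_eq_mul, nsmul_eq_mul]; ring
    _ ≤ (4 * Real.exp (2 * c) * d * d * S + 1) * #(box d n) := by
        refine mul_le_mul_of_nonneg_right (by linarith) (Nat.cast_nonneg _)

end BoundaryInfluence

end Summit.CriticalPhenomena.PercolationContinuityZ3.Theorems.FK

end
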